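import Literature.ModelTheory.Zilber.EACDensityQuestion
import Literature.Geometry.Symplectic.JRotationBranchSolve
import HarnessLib

/-!
# Degenerate escape decides Mantova–Masser's density question for FAMILIES of surfaces
# `S_{p,q} = {x₁ = p(x₀), y₀ = q(y₁)}`: the leading-coefficient criterion

Continuation of `EACDensityQuestion.lean` (Mantova–Masser, Proc. LMS 2024 = arXiv:2303.05592, §1
p. 5 "Further remarks": in case (dim-pi-S-1-free) — `S ⊂ ℂ² × G²` an irreducible surface,
`dim cl π(S ∩ G²) = 1`, `cl π(S ∩ G²)` not a line of rational slope — is `S ∩ Γ_exp` Zariski dense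
in `S`? Dictionary: `MMCaseDimPiOneFree`, `UnprojectedDense`). There the mechanism *degenerate
escape + Liouville elimination* decided the question for the parabola surface `S_par` and decided
Mantova–Masser's sentence for their Fermat example. Here the mechanism is ABSTRACTED and run on the
two-parameter family `S_{p,q}` (`p, q ∈ ℂ[X]`), a graph-fibre variety with coordinate ring
`ℂ[x₀, y₁]` whose exponential points are the `(z, p(z), q(w), w)` with `e^z = q(w)`, `e^{p(z)} = w`.

* `unprojectedDense_graphPolySurface_of_seq` (elimination): ANY sequence of exponential points
  with `‖z_k‖ → ∞`, `w_k ≠ 0`, `‖w_k‖ ‖z_k‖^N → 0 (∀ N)` makes `S_{p,q} ∩ Γ_exp` Zariski dense.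
* `exists_degenerateSeq` (escape): such a sequence EXISTS as soon as `q(0) ≠ 0` and `Re p → -∞`
  (at least linearly) on the unit discs around a divergent sequence of points of `log q(0) + 2πiℤ`:
  there `e^{p}` is tiny, the system degenerates to `e^z = q(0)`, and the tree's contraction lemma
  (`ExpDominant.exists_exp_eq_one_add`, via `exists_exp_eq_one_sub_of_small`) solves it.
* `unprojectedDense_graphPolySurface_of_leadingCoeff` (**leading-coefficient criterion**): if
  `deg p = d ≥ 1` and `Re(a_d (σ i)^d) < 0` for a sign `σ = ±1` (`a_d` the leading coefficient), and
  `q(0) ≠ 0`, then the exponential points of `S_{p,q}` are Zariski dense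
  (`Re p(log q(0) + 2π(k+1)σi + u) ≤ -λ T_k^d + C T_k^{d-1}`, `T_k = 2π(k+1)`; `re_eval_add_le`,
  with the telescoping bound `RotationBranch.norm_pow_sub_pow_le` of the tree).
* `mmCase_graphPolySurface_of_leadingCoeff`: every such `S_{p,q}` (`q ≠ 0`) satisfies ALL hypotheses
  of case (dim-pi-S-1-free) (a polynomial graph of degree `≥ 2` is no line; for `d = 1` the criterion
  reads `Im a₁ ≠ 0`, and a line of non-real slope is not of rational slope), so the question is
  answered YES on the whole family (`unprojectedDensityQuestion_instance_leadingCoeff`); special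
  cases: ALL lines `x₁ = a x₀ + b` of NON-REAL slope (`unprojectedDensityQuestion_instance_line`,
  e.g. `e^z + e^{iz} = 1`), the parabola `x₁ = x₀²` (`graphPolySurface_sq_eq_mmParabola`),
  `x₁ = i x₀³`, `x₁ = -x₀⁴`, with any fibre `y₀ = q(y₁)`, `q(0) ≠ 0`.

PRIOR ART FOR THE LINE SUB-FAMILY (Gallinaro, Selecta Math. 2023 = arXiv:2203.13767). For `L ⊆ ℂⁿ`
a LINEAR space with `L × W` additively free and rotund, Gallinaro proves `exp(L) ∩ W ≠ ∅` (Thm. 8.8)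
and that `exp(L) ∩ W` is Zariski dense IN `W` (Cor. 8.10; Cor. 6.17 for `L` defined over `ℝ`); his
Example 8.9 is `{i z₁ = z₂, w₁ + w₂ + 1 = 0}`, i.e. `e^z + e^{iz} = -1`. So for a line base
(`b = 0` without loss: `y₁ ↦ e^{-b} y₁`) of any irrational slope, EXISTENCE of exponential points and
density of their multiplicative PROJECTIONS are in print. What this file adds for non-real slopes is
the UNPROJECTED density Mantova–Masser ask about — density of the points `(z, e^z)` in `S` itself,
i.e. (the exponential points being a graph over `exp(L) ∩ W` when the slope is irrational) the absence
of any algebraic relation `G(x₀, y₁) = 0` along the solutions — by a different, elementary mechanism;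
for bases of degree `≥ 2` Gallinaro's theorem does not apply (existence there is Mantova–Masser's
Thm. 1.1/1.2, which is NOT used here).

HONEST FRAMING. NOT decided here and OPEN as far as we know: UNPROJECTED density for bases
`x₁ = a x₀ + b` with `a` REAL irrational (projected density is Gallinaro's Cor. 8.10; the members are
oscillatory, `|e^{x₁}| = |e^{b}| |e^{x₀}|^a`, and admit no degenerate regime), `x₁ = -x₀²`, `x₁ = x₀³`
(real leading coefficient in odd degree), non-graph fibres, and the general question. Elementary
mathematics, possibly folklore; new in this packet as a decided sub-family of a question raised in
print. Nothing here bears on `ECCell 3 2` (OPEN) or on Schanuel's conjecture (EAC ⇏ SC); no statement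
of Mantova–Masser or Gallinaro is used as a hypothesis.
-/

noncomputable section

open Filter Topology MvPolynomial Complex

namespace Literature.ModelTheory.Zilber

open Literature.NumberTheory.Transcendental Literature.ModelTheory.ExponentialFields

/-! ### The surfaces `{x₁ = p(x₀), y₀ = q(y₁)}` -/

section Surface

/-- Evaluating the one-variable polynomial `p(Xᵢ)` regarded in `ℂ[X_σ]`. [folklore] -/
theorem eval_polynomial_aeval_X {σ : Type*} (x : σ → ℂ) (i : σ) (p : Polynomial ℂ) :
    MvPolynomial.eval x (Polynomial.aeval (X i : MvPolynomial σ ℂ) p) = p.eval (x i) := by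
  induction p using Polynomial.induction_on' with
  | add p q hp hq => simp [hp, hq]
  | monomial n a => simp [Polynomial.aeval_monomial, MvPolynomial.algebraMap_eq]

variable (p q : Polynomial ℂ)

/-- **`S_{p,q} = {x₁ = p(x₀), y₀ = q(y₁)} ⊆ ℂ² × ℂ²`** as a graph-fibre variety `W(p(x₀); q(u))`.
For `p = X²`, `q = 1 - X` this is `S_par` of `EACDensityQuestion`; for `p` of degree one the base is
a line. [folklore] -/
def graphPolySurface : Set (Fin 2 ⊕ Fin 2 → ℂ) :=
  graphFibreVariety (Polynomial.aeval (X 0 : MvPolynomial (Fin 1) ℂ) p)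
    ![Polynomial.aeval (X 0 : MvPolynomial (Fin 2) ℂ) q]

/-- Membership in `S_{p,q}`. [folklore] -/
theorem mem_graphPolySurface_iff (z : Fin 2 ⊕ Fin 2 → ℂ) :
    z ∈ graphPolySurface p q ↔
      z (Sum.inl 1) = p.eval (z (Sum.inl 0)) ∧ z (Sum.inr 0) = q.eval (z (Sum.inr 1)) := by
  rw [graphPolySurface, mem_graphFibreVariety_iff, Fin.forall_fin_one]
  simp only [eval_polynomial_aeval_X, Matrix.cons_val_zero, Fin.cons_zero, Fin.castSucc_zero]
  exact Iff.rfl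

/-- The parametrisation `(u, w) ↦ (u, p(u), q(w), w)`. [folklore] -/
def gpParam (u w : ℂ) : Fin 2 ⊕ Fin 2 → ℂ := Sum.elim ![u, p.eval u] ![q.eval w, w]

/-- Coordinate `x₀`. [folklore] -/
@[simp] theorem gpParam_inl_zero (u w : ℂ) : gpParam p q u w (Sum.inl 0) = u := rfl
/-- Coordinate `x₁`. [folklore] -/
@[simp] theorem gpParam_inl_one (u w : ℂ) : gpParam p q u w (Sum.inl 1) = p.eval u := rfl
/-- Coordinate `y₀`. [folklore] -/
@[simp] theorem gpParam_inr_zero (u w : ℂ) : gpParam p q u w (Sum.inr 0) = q.eval w := rfl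
/-- Coordinate `y₁`. [folklore] -/
@[simp] theorem gpParam_inr_one (u w : ℂ) : gpParam p q u w (Sum.inr 1) = w := rfl

/-- `gpParam p q u w ∈ S_{p,q}`. [folklore] -/
theorem gpParam_mem (u w : ℂ) : gpParam p q u w ∈ graphPolySurface p q := by
  rw [mem_graphPolySurface_iff]; exact ⟨rfl, rfl⟩

/-- Every point of `S_{p,q}` is a `gpParam`. [folklore] -/
theorem eq_gpParam_of_mem {s : Fin 2 ⊕ Fin 2 → ℂ} (hs : s ∈ graphPolySurface p q) :
    s = gpParam p q (s (Sum.inl 0)) (s (Sum.inr 1)) := by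
  rw [mem_graphPolySurface_iff] at hs
  funext i
  rcases i with i | i <;> fin_cases i
  · rfl
  · exact hs.1
  · exact hs.2
  · rfl

/-- The exponential points of `S_{p,q}`: `(u, p(u), q(w), w)` with `e^u = q(w)`, `e^{p(u)} = w`.
[folklore] -/
theorem gpParam_mem_expGraph {u w : ℂ} (hu : exp u = q.eval w) (hw : exp (p.eval u) = w) :
    gpParam p q u w ∈ expGraph ℂ 2 := by
  rw [mem_expGraph_iff]
  intro i
  fin_cases i
  · simp [ExponentialRing.complex_exp_eq, hu]
  · simp [ExponentialRing.complex_exp_eq, hw]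

/-- The symbolic parametrisation in `ℂ[z][w]`: `x₀ ↦ z`, `x₁ ↦ p(z)`, `y₀ ↦ q(w)`, `y₁ ↦ w`.
[folklore] -/
def gpSymb : Fin 2 ⊕ Fin 2 → Polynomial (Polynomial ℂ) :=
  Sum.elim ![Polynomial.C Polynomial.X, Polynomial.C p] ![q.map Polynomial.C, Polynomial.X]

/-- Pull-back of `F ∈ ℂ[x₀, x₁, y₀, y₁]` to `ℂ[z][w]` along `gpSymb`. [folklore] -/
def gpPullback (F : MvPolynomial (Fin 2 ⊕ Fin 2) ℂ) : Polynomial (Polynomial ℂ) :=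
  eval₂Hom (Polynomial.C.comp Polynomial.C) (gpSymb p q) F

/-- `mmEval u w` on an inner polynomial `r(z)` is `r(u)`. [folklore] -/
@[simp] theorem mmEval_C (u w : ℂ) (r : Polynomial ℂ) : mmEval u w (Polynomial.C r) = r.eval u := by
  simp [mmEval]

/-- `mmEval u w` on an outer polynomial `r(w)` (constant coefficients) is `r(w)`. [folklore] -/
@[simp] theorem mmEval_map_C (u w : ℂ) (r : Polynomial ℂ) :
    mmEval u w (r.map Polynomial.C) = r.eval w := by
  induction r using Polynomial.induction_on' with
  | add r s hr hs => simp only [Polynomial.map_add, map_add, hr, hs, Polynomial.eval_add]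
  | monomial n a => simp [mmEval]

/-- `mmEval u w` on the symbols `gpSymb` gives the coordinates of `gpParam p q u w`. [folklore] -/
theorem mmEval_gpSymb (u w : ℂ) : (fun i => mmEval u w (gpSymb p q i)) = gpParam p q u w := by
  funext i
  rcases i with i | i <;> fin_cases i <;> simp [gpSymb, gpParam]

/-- **The pull-back evaluates to `F` on the parametrised point.** [folklore] -/
theorem mmEval_gpPullback (F : MvPolynomial (Fin 2 ⊕ Fin 2) ℂ) (u w : ℂ) :
    mmEval u w (gpPullback p q F) = MvPolynomial.eval (gpParam p q u w) F := by
  rw [gpPullback, ← RingHom.comp_apply, MvPolynomial.comp_eval₂Hom, mmEval_comp_C, mmEval_gpSymb]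
  rfl

/-- **Abstract density criterion (Liouville elimination).** If `S_{p,q}` carries exponential points
`(z_k, p(z_k), q(w_k), w_k)` with `‖z_k‖ → ∞`, `w_k ≠ 0` and `‖w_k‖ ‖z_k‖^N → 0` for every `N`,
then its exponential points are Zariski dense: `I(S_{p,q} ∩ Γ_exp) = I(S_{p,q})`.
(new in this file) [folklore] -/
theorem unprojectedDense_graphPolySurface_of_seq (z w : ℕ → ℂ)
    (hz : Tendsto (fun k => ‖z k‖) atTop atTop) (hw : ∀ k, w k ≠ 0)
    (hdec : ∀ N : ℕ, Tendsto (fun k => ‖w k‖ * ‖z k‖ ^ N) atTop (𝓝 0))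
    (hexp₁ : ∀ k, exp (z k) = q.eval (w k)) (hexp₂ : ∀ k, exp (p.eval (z k)) = w k) :
    UnprojectedDense (graphPolySurface p q) := by
  refine le_antisymm ?_ (vanishingIdeal_anti_mono Set.inter_subset_left)
  intro F hF
  have hG0 : gpPullback p q F = 0 := by
    refine eq_zero_of_eval₂_eq_zero_of_superdecay (gpPullback p q F) z w hz hw hdec fun k => ?_
    rw [← mmEval_eq_eval₂, mmEval_gpPullback, ← coe_aeval_eq_eval]
    exact (mem_vanishingIdeal_iff.mp hF) _
      ⟨gpParam_mem p q _ _, gpParam_mem_expGraph p q (hexp₁ k) (hexp₂ k)⟩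
  rw [mem_vanishingIdeal_iff]
  intro s hs
  have h := mmEval_gpPullback p q F (s (Sum.inl 0)) (s (Sum.inr 1))
  rw [hG0, map_zero, ← eq_gpParam_of_mem p q hs] at h
  simpa [coe_aeval_eq_eval] using h.symm

/-! #### Case certificate: `S_{p,q}` is an irreducible surface over the curve `x₁ = p(x₀)` -/

/-- `S_{p,q}` is irreducible Zariski closed. [folklore] -/
theorem isIrreducibleClosed_graphPolySurface : IsIrreducibleClosed ℂ (graphPolySurface p q) := by
  rw [graphPolySurface, graphFibreVariety_eq_polyFibredGraph]
  exact isIrreducibleClosed_polyFibredGraph _ _ _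

/-- `dim S_{p,q} = 2`. [folklore] -/
theorem zariskiDim_graphPolySurface : zariskiDim ℂ (graphPolySurface p q) = (2 : ℕ) := by
  rw [graphPolySurface, graphFibreVariety_eq_polyFibredGraph]
  exact zariskiDim_polyFibredGraph _ _ _

/-- A nonzero polynomial omits a nonzero non-root. [folklore] -/
theorem exists_ne_zero_eval_ne_zero {q : Polynomial ℂ} (hq : q ≠ 0) :
    ∃ w : ℂ, w ≠ 0 ∧ q.eval w ≠ 0 := by
  have hfin : ({x : ℂ | q.IsRoot x} ∪ {0}).Finite :=
    (Polynomial.finite_setOf_isRoot hq).union (Set.finite_singleton 0)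
  obtain ⟨w, hw⟩ := hfin.infinite_compl.nonempty
  simp only [Set.mem_compl_iff, Set.mem_union, Set.mem_setOf_eq, Set.mem_singleton_iff,
    not_or] at hw
  exact ⟨w, hw.2, hw.1⟩

variable {q}

/-- The torus part of `S_{p,q}` is non-empty (`q ≠ 0`). [folklore] -/
theorem graphPolySurface_inter_torusLocus_nonempty (hq : q ≠ 0) :
    (graphPolySurface p q ∩ torusLocus ℂ 2).Nonempty := by
  obtain ⟨w, hw0, hqw⟩ := exists_ne_zero_eval_ne_zero hq
  refine ⟨gpParam p q 0 w, gpParam_mem p q 0 w, ?_⟩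
  rw [mem_torusLocus_iff]
  intro i; fin_cases i
  · simpa using hqw
  · simpa using hw0

/-- `π(S_{p,q} ∩ G²)` is the whole curve `{x₁ = p(x₀)}` (`q ≠ 0`). [folklore] -/
theorem projAdd_image_graphPolySurface_inter_torusLocus (hq : q ≠ 0) :
    projAdd '' (graphPolySurface p q ∩ torusLocus ℂ 2) =
      graphBase (Polynomial.aeval (X 0 : MvPolynomial (Fin 1) ℂ) p) := by
  obtain ⟨w, hw0, hqw⟩ := exists_ne_zero_eval_ne_zero hq
  ext x
  simp only [Set.mem_image, Set.mem_inter_iff, graphBase, Set.mem_setOf_eq,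
    eval_polynomial_aeval_X]
  constructor
  · rintro ⟨z, ⟨hz, -⟩, rfl⟩
    rw [mem_graphPolySurface_iff] at hz
    simpa using hz.1
  · intro hx
    refine ⟨gpParam p q (x 0) w, ⟨gpParam_mem p q _ _, ?_⟩, ?_⟩
    · rw [mem_torusLocus_iff]; intro i; fin_cases i
      · simpa using hqw
      · simpa using hw0
    · funext i
      fin_cases i
      · rfl
      · simpa using hx.symm

/-- `dim cl π(S_{p,q} ∩ G²) = 1` (`q ≠ 0`). [folklore] -/
theorem addProjDim_graphPolySurface (hq : q ≠ 0) : addProjDim ℂ 2 (graphPolySurface p q) = (1 : ℕ) := by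
  unfold addProjDim zariskiDim
  rw [projAdd_image_graphPolySurface_inter_torusLocus p hq, vanishingIdeal_graphBase,
    ringKrullDim_eq_of_ringEquiv
      (Ideal.quotientKerAlgEquivOfSurjective (graphSubst_surjective _)).toRingEquiv,
    MvPolynomial.ringKrullDim_of_isNoetherianRing, ringKrullDim_eq_zero_of_field,
    Nat.card_eq_fintype_card, Fintype.card_fin, zero_add]

/-- Points of the base curve lie in the Zariski closure of `π(S_{p,q} ∩ G²)`. [folklore] -/
theorem mem_zeroLocus_projAdd_graphPolySurface (hq : q ≠ 0) {x : Fin 2 → ℂ}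
    (hx : x 1 = p.eval (x 0)) :
    x ∈ zeroLocus ℂ (vanishingIdeal ℂ (projAdd '' (graphPolySurface p q ∩ torusLocus ℂ 2))) := by
  rw [projAdd_image_graphPolySurface_inter_torusLocus p hq, mem_zeroLocus_iff]
  intro r hr
  refine (mem_vanishingIdeal_iff.mp hr) x ?_
  simp only [graphBase, Set.mem_setOf_eq, eval_polynomial_aeval_X]
  simpa using hx

/-- Reduction of "the base curve `x₁ = p(x₀)` is not a line of rational slope" to an identity of
polynomial functions: if `m₀ x + m₁ p(x) ≡ c` forces `m₀ = m₁ = 0`, then `cl π(S_{p,q} ∩ G²)` is not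
a line of rational slope (`q ≠ 0`). [folklore] -/
theorem not_isRationalSlopeLine_graphPolySurface (hq : q ≠ 0)
    (h : ∀ (m₀ m₁ : ℤ) (c : ℂ), (∀ x : ℂ, (m₀ : ℂ) * x + (m₁ : ℂ) * p.eval x = c) →
      m₀ = 0 ∧ m₁ = 0) :
    ¬ IsRationalSlopeLine
      (zeroLocus ℂ (vanishingIdeal ℂ (projAdd '' (graphPolySurface p q ∩ torusLocus ℂ 2)))) := by
  rintro ⟨m, hm, c, hL⟩
  have hsub : ∀ x : ℂ, (m 0 : ℂ) * x + (m 1 : ℂ) * p.eval x = c := by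
    intro x
    have hxZ := mem_zeroLocus_projAdd_graphPolySurface p hq (x := ![x, p.eval x]) (by simp)
    rw [hL] at hxZ
    simpa using hxZ
  obtain ⟨h0, h1⟩ := h (m 0) (m 1) c hsub
  exact hm (funext fun i => by fin_cases i <;> assumption)

end Surface

/-! ### Degenerate escape: the supply of super-decaying exponential points -/

section Supply

/-- `Σᵢ ‖qᵢ‖`, a crude Lipschitz constant of `q` on the unit disc. [folklore] -/
def coeffNormSum (q : Polynomial ℂ) : ℝ := ∑ i ∈ Finset.range (q.natDegree + 1), ‖q.coeff i‖

/-- `0 ≤ Σ ‖qᵢ‖`. [folklore] -/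
theorem coeffNormSum_nonneg (q : Polynomial ℂ) : 0 ≤ coeffNormSum q :=
  Finset.sum_nonneg fun _ _ => norm_nonneg _

/-- `‖q(w) - q(0)‖ ≤ (Σ ‖qᵢ‖) ‖w‖` for `‖w‖ ≤ 1`. [folklore] -/
theorem norm_eval_sub_eval_zero_le (q : Polynomial ℂ) {w : ℂ} (hw : ‖w‖ ≤ 1) :
    ‖q.eval w - q.eval 0‖ ≤ coeffNormSum q * ‖w‖ := by
  rw [Polynomial.eval_eq_sum_range, Polynomial.eval_eq_sum_range, ← Finset.sum_sub_distrib,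
    coeffNormSum, Finset.sum_mul]
  refine (norm_sum_le _ _).trans (Finset.sum_le_sum fun i _ => ?_)
  rw [← mul_sub, norm_mul]
  refine mul_le_mul_of_nonneg_left ?_ (norm_nonneg _)
  rcases Nat.eq_zero_or_pos i with rfl | hi
  · simp
  · rw [zero_pow hi.ne', sub_zero, norm_pow]
    calc ‖w‖ ^ i ≤ ‖w‖ ^ 1 := pow_le_pow_of_le_one (norm_nonneg _) hw hi
      _ = ‖w‖ := pow_one _

variable (p q : Polynomial ℂ)

/-- The correction `P(ζ) = 1 - q(e^{p(c₀ + ζ)})/q(0)`: `e^{c₀ + ζ} = q(e^{p(c₀+ζ)})` iff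
`e^{ζ} = 1 - P(ζ)` (`e^{c₀} = q(0)`). [folklore] -/
def degCorr (c₀ ζ : ℂ) : ℂ := 1 - q.eval (exp (p.eval (c₀ + ζ))) / q.eval 0

/-- The correction is entire. [folklore] -/
theorem differentiable_degCorr (c₀ : ℂ) : Differentiable ℂ (degCorr p q c₀) := by
  unfold degCorr
  have h1 : Differentiable ℂ fun ζ : ℂ => p.eval (c₀ + ζ) :=
    (Polynomial.differentiable p).comp ((differentiable_const c₀).add differentiable_id)
  have h2 : Differentiable ℂ fun ζ : ℂ => q.eval (exp (p.eval (c₀ + ζ))) :=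
    (Polynomial.differentiable q).comp h1.cexp
  exact (differentiable_const 1).sub (h2.div_const _)

variable {p q}

/-- Smallness of the correction from smallness of `e^{p}`. [folklore] -/
theorem norm_degCorr_le (hq0 : q.eval 0 ≠ 0) {c₀ ζ : ℂ} {K : ℝ} (hK : 0 ≤ K)
    (hre : (p.eval (c₀ + ζ)).re ≤ -K) :
    ‖degCorr p q c₀ ζ‖ ≤ coeffNormSum q / ‖q.eval 0‖ * Real.exp (-K) := by
  have hw : ‖exp (p.eval (c₀ + ζ))‖ ≤ Real.exp (-K) := by
    rw [norm_exp]; exact Real.exp_le_exp.2 hre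
  have hw1 : ‖exp (p.eval (c₀ + ζ))‖ ≤ 1 := hw.trans (by rw [Real.exp_le_one_iff]; linarith)
  have h := norm_eval_sub_eval_zero_le q hw1
  have hq : 0 < ‖q.eval 0‖ := norm_pos_iff.2 hq0
  rw [degCorr, show (1 : ℂ) - q.eval (exp (p.eval (c₀ + ζ))) / q.eval 0 =
      -((q.eval (exp (p.eval (c₀ + ζ))) - q.eval 0) / q.eval 0) by field_simp; ring,
    norm_neg, norm_div, div_le_iff₀ hq]
  calc ‖q.eval (exp (p.eval (c₀ + ζ))) - q.eval 0‖ ≤ coeffNormSum q * ‖exp (p.eval (c₀ + ζ))‖ := h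
    _ ≤ coeffNormSum q * Real.exp (-K) := mul_le_mul_of_nonneg_left hw (coeffNormSum_nonneg q)
    _ = coeffNormSum q / ‖q.eval 0‖ * Real.exp (-K) * ‖q.eval 0‖ := by
      field_simp

/-- **Degenerate escape supplies super-decaying exponential points.** Let `q(0) ≠ 0`,
`c₀ = log q(0)`, and let `c_k ∈ 2πiℤ` (i.e. `e^{c_k} = 1`) with `‖c_k‖ → ∞`; suppose, for
all large `k`, `Re p(c₀ + c_k + u) ≤ -K_k` for all `‖u‖ < 1`, where `K_k → ∞` at least linearly
in `‖c_k‖` (`‖c_k‖ ≤ A₁ K_k + A₀`). Then there are exponential points `(z_j, p(z_j), q(w_j), w_j)` of `S_{p,q}`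
(`e^{z_j} = q(w_j)`, `e^{p(z_j)} = w_j`) with `‖z_j‖ → ∞`, `w_j ≠ 0`, `‖w_j‖ ‖z_j‖^N → 0`.
Proof: for large `k` the correction `P_k` has `‖P_k‖ ≤ 1/32` on the unit disc around `c_k`, the
contraction lemma solves `e^{ζ} = 1 - P_k(ζ)` within `1/2` of `c_k`, and `z = c₀ + ζ`,
`w = e^{p(z)}` (`‖w‖ ≤ e^{-K_k}`). (new in this file) [folklore] -/
theorem exists_degenerateSeq (hq0 : q.eval 0 ≠ 0) (c : ℕ → ℂ) (hc : ∀ k, exp (c k) = 1)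
    (hcat : Tendsto (fun k => ‖c k‖) atTop atTop) (K : ℕ → ℝ) (hK : Tendsto K atTop atTop)
    (A₁ A₀ : ℝ) (hcK : ∀ᶠ k in atTop, ‖c k‖ ≤ A₁ * K k + A₀)
    (hre : ∀ᶠ k in atTop, ∀ u : ℂ, ‖u‖ < 1 → (p.eval (log (q.eval 0) + c k + u)).re ≤ -K k) :
    ∃ z w : ℕ → ℂ, Tendsto (fun j => ‖z j‖) atTop atTop ∧ (∀ j, w j ≠ 0) ∧
      (∀ N : ℕ, Tendsto (fun j => ‖w j‖ * ‖z j‖ ^ N) atTop (𝓝 0)) ∧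
      (∀ j, exp (z j) = q.eval (w j)) ∧ ∀ j, exp (p.eval (z j)) = w j := by
  set c₀ : ℂ := log (q.eval 0) with hc₀
  have hexpc₀ : exp c₀ = q.eval 0 := exp_log hq0
  set B : ℝ := coeffNormSum q / ‖q.eval 0‖ with hB
  have hB0 : 0 ≤ B := div_nonneg (coeffNormSum_nonneg q) (norm_nonneg _)
  -- eventually: K ≥ 0, B e^{-K} ≤ 1/32, K ≥ A₀ + ‖c₀‖ + 1/2
  have hev₁ : ∀ᶠ k in atTop, 0 ≤ K k := hK.eventually_ge_atTop 0
  have hev₂ : ∀ᶠ k in atTop, B * Real.exp (-K k) ≤ 1 / 32 := by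
    have ht : Tendsto (fun k => B * Real.exp (-K k)) atTop (𝓝 (B * 0)) :=
      (Real.tendsto_exp_atBot.comp (tendsto_neg_atTop_atBot.comp hK)).const_mul B
    rw [mul_zero] at ht
    exact ht.eventually (ge_mem_nhds (by norm_num))
  have hev₃ : ∀ᶠ k in atTop, A₀ + ‖c₀‖ + 1 / 2 ≤ K k := hK.eventually_ge_atTop _
  obtain ⟨K₀, hK₀⟩ := eventually_atTop.1 (hev₁.and (hev₂.and (hev₃.and (hcK.and hre))))
  -- solve on each disc, for k = j + K₀
  have hsol : ∀ j : ℕ, ∃ ζ : ℂ, ‖ζ - c (j + K₀)‖ ≤ 1 / 2 ∧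
      exp ζ = 1 - degCorr p q c₀ ζ := by
    intro j
    obtain ⟨h1, h2, -, -, h5⟩ := hK₀ (j + K₀) (Nat.le_add_left _ _)
    refine exists_exp_eq_one_sub_of_small (c (j + K₀)) (hc _) (degCorr p q c₀)
      (differentiable_degCorr p q c₀).differentiableOn fun ζ hζ => ?_
    rw [Metric.mem_ball, dist_eq_norm] at hζ
    have := h5 (ζ - c (j + K₀)) hζ
    rw [add_assoc, add_sub_cancel] at this
    exact (norm_degCorr_le hq0 h1 this).trans h2
  choose ζ hζ using hsol
  refine ⟨fun j => c₀ + ζ j, fun j => exp (p.eval (c₀ + ζ j)), ?_, fun j => exp_ne_zero _, ?_,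
    fun j => ?_, fun j => rfl⟩
  · -- ‖z_j‖ ≥ ‖c_{j+K₀}‖ - ‖c₀‖ - 1/2 → ∞
    refine tendsto_norm_atTop_of_le (hcat.comp (tendsto_add_atTop_nat K₀)) (a := 1)
      (b := ‖c₀‖ + 1 / 2) one_pos fun j => ?_
    have h1 := (hζ j).1
    have h2 : ‖c (j + K₀)‖ ≤ ‖c₀ + ζ j‖ + ‖c₀‖ + ‖ζ j - c (j + K₀)‖ :=
      calc ‖c (j + K₀)‖ = ‖(c₀ + ζ j) - c₀ - (ζ j - c (j + K₀))‖ := by congr 1; ring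
        _ ≤ ‖(c₀ + ζ j) - c₀‖ + ‖ζ j - c (j + K₀)‖ := norm_sub_le _ _
        _ ≤ ‖c₀ + ζ j‖ + ‖c₀‖ + ‖ζ j - c (j + K₀)‖ := add_le_add (norm_sub_le _ _) le_rfl
    simp only [Function.comp_apply, one_mul]
    linarith
  · -- super-decay with scale K (j + K₀)
    intro N
    refine superdecay_of_le (hK.comp (tendsto_add_atTop_nat K₀)) (A := A₁ + 1)
      (fun j => ?_) (fun j => ?_) N
    · obtain ⟨-, -, h3, h4, -⟩ := hK₀ (j + K₀) (Nat.le_add_left _ _)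
      have h1 := (hζ j).1
      have h2 : ‖c₀ + ζ j‖ ≤ ‖c₀‖ + ‖ζ j - c (j + K₀)‖ + ‖c (j + K₀)‖ :=
        calc ‖c₀ + ζ j‖ = ‖c₀ + (ζ j - c (j + K₀)) + c (j + K₀)‖ := by congr 1; ring
          _ ≤ ‖c₀ + (ζ j - c (j + K₀))‖ + ‖c (j + K₀)‖ := norm_add_le _ _
          _ ≤ ‖c₀‖ + ‖ζ j - c (j + K₀)‖ + ‖c (j + K₀)‖ := add_le_add (norm_add_le _ _) le_rfl
      simp only [Function.comp_apply]
      nlinarith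
    · obtain ⟨-, -, -, -, h5⟩ := hK₀ (j + K₀) (Nat.le_add_left _ _)
      simp only [Function.comp_apply, norm_exp]
      refine Real.exp_le_exp.2 ?_
      have h1 := (hζ j).1
      have := h5 (ζ j - c (j + K₀)) (by linarith)
      rwa [add_assoc, add_sub_cancel] at this
  · -- the equation `e^{z} = q(w)`
    rw [exp_add, (hζ j).2, hexpc₀, degCorr]
    field_simp
    ring

/-- **Degenerate escape + elimination**: under the hypotheses of `exists_degenerateSeq` the
exponential points of `S_{p,q}` are Zariski dense. (new in this file) [folklore] -/
theorem unprojectedDense_graphPolySurface_of_degenerate (hq0 : q.eval 0 ≠ 0) (c : ℕ → ℂ)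
    (hc : ∀ k, exp (c k) = 1) (hcat : Tendsto (fun k => ‖c k‖) atTop atTop) (K : ℕ → ℝ)
    (hK : Tendsto K atTop atTop) (A₁ A₀ : ℝ) (hcK : ∀ᶠ k in atTop, ‖c k‖ ≤ A₁ * K k + A₀)
    (hre : ∀ᶠ k in atTop, ∀ u : ℂ, ‖u‖ < 1 → (p.eval (log (q.eval 0) + c k + u)).re ≤ -K k) :
    UnprojectedDense (graphPolySurface p q) := by
  obtain ⟨z, w, hz, hw, hdec, h₁, h₂⟩ := exists_degenerateSeq hq0 c hc hcat K hK A₁ A₀ hcK hre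
  exact unprojectedDense_graphPolySurface_of_seq p q z w hz hw hdec h₁ h₂

end Supply

/-! ### Lines of non-real slope -/

section Line

variable (a b : ℂ) (q : Polynomial ℂ)

/-- The base line `x₁ = a x₀ + b` as a polynomial. [folklore] -/
def linePoly : Polynomial ℂ := Polynomial.C a * Polynomial.X + Polynomial.C b

/-- `(aX+b)(z) = az+b`. [folklore] -/
@[simp] theorem eval_linePoly (z : ℂ) : (linePoly a b).eval z = a * z + b := by
  simp [linePoly]

/-- The escape centres `± 2πi(k+1)`, with the sign of `Im a` (so that `Re(a c_k) = -2π(k+1)|Im a|`).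
[folklore] -/
def lineCentreInt (k : ℕ) : ℤ := if 0 < a.im then (k : ℤ) + 1 else -((k : ℤ) + 1)

/-- See `lineCentreInt`. [folklore] -/
def lineCentre (k : ℕ) : ℂ := (lineCentreInt a k : ℂ) * (2 * Real.pi * I)

/-- `e^{c_k} = 1`. [folklore] -/
theorem exp_lineCentre (k : ℕ) : exp (lineCentre a k) = 1 := by
  rw [lineCentre]; exact exp_int_mul_two_pi_mul_I _

/-- `|n_k| = k + 1`. [folklore] -/
theorem abs_lineCentreInt (k : ℕ) : |((lineCentreInt a k : ℤ) : ℝ)| = (k : ℝ) + 1 := by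
  unfold lineCentreInt
  split_ifs
  · push_cast; exact abs_of_pos (by positivity)
  · push_cast; rw [abs_neg]; exact abs_of_pos (by positivity)

/-- `‖c_k‖ = 2π(k+1)`. [folklore] -/
theorem norm_lineCentre (k : ℕ) : ‖lineCentre a k‖ = 2 * Real.pi * ((k : ℝ) + 1) := by
  have h : ‖(2 : ℂ) * (Real.pi : ℂ) * I‖ = 2 * Real.pi := by simp [abs_of_pos Real.pi_pos]
  rw [lineCentre, norm_mul, Complex.norm_intCast, abs_lineCentreInt, h]
  ring

/-- `Re(a c_k) = -2π(k+1)|Im a|`. [folklore] -/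
theorem re_mul_lineCentre (k : ℕ) : (a * lineCentre a k).re = -(2 * Real.pi * ((k : ℝ) + 1) * |a.im|) := by
  have h : (a * lineCentre a k).re = -(2 * Real.pi * (lineCentreInt a k : ℝ) * a.im) := by
    rw [lineCentre]
    simp only [mul_re, mul_im, Complex.intCast_re, Complex.intCast_im, I_re, I_im,
      Complex.ofReal_re, Complex.ofReal_im, re_ofNat, im_ofNat, mul_zero, zero_mul, sub_zero,
      add_zero, mul_one, Complex.mul_re, Complex.mul_im]
    ring
  rw [h]
  unfold lineCentreInt
  split_ifs with him
  · rw [abs_of_pos him]; push_cast; ring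
  · rw [abs_of_nonpos (not_lt.1 him)]; push_cast; ring

variable {a}

/-- **Unprojected density for lines of non-real slope.** For `Im a ≠ 0` and `q(0) ≠ 0` the
exponential points of `{x₁ = a x₀ + b, y₀ = q(y₁)}` — the `(z, az+b, q(w), w)` with `e^z = q(w)`,
`e^{az+b} = w` — are Zariski dense in the surface. (Degenerate regime: `Re(a z) → -∞` along
`z ≈ log q(0) ± 2πik`.) Existence of such points and Zariski density of their projections `(q(w), w)`
in the fibre curve are Gallinaro's Thm. 8.8 / Cor. 8.10 (arXiv:2203.13767; linear `L`, `L × W` free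
rotund; his Ex. 8.9 is `e^z + e^{iz} = -1`); the density in the surface is the new statement.
(new in this file) [folklore] -/
theorem unprojectedDense_lineSurface (ha : a.im ≠ 0) (hq0 : q.eval 0 ≠ 0) :
    UnprojectedDense (graphPolySurface (linePoly a b) q) := by
  set c₀ : ℂ := log (q.eval 0)
  set M : ℝ := ‖a * c₀ + b‖ + ‖a‖
  have hia : 0 < |a.im| := abs_pos.2 ha
  refine unprojectedDense_graphPolySurface_of_degenerate hq0 (lineCentre a) (exp_lineCentre a)
    ?_ (fun k => 2 * Real.pi * ((k : ℝ) + 1) * |a.im| - M) ?_ (1 / |a.im|) (M / |a.im|)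
    (Eventually.of_forall fun k => ?_) (Eventually.of_forall fun k u hu => ?_)
  · simp only [norm_lineCentre]
    exact (tendsto_natCast_add_atTop 1).const_mul_atTop Real.two_pi_pos
  · refine tendsto_atTop_add_const_right _ _ (Tendsto.atTop_mul_const hia ?_)
    exact (tendsto_natCast_add_atTop 1).const_mul_atTop Real.two_pi_pos
  · rw [norm_lineCentre]
    field_simp
    nlinarith [Real.pi_pos]
  · rw [eval_linePoly, show a * (c₀ + lineCentre a k + u) + b =
      (a * c₀ + b) + a * lineCentre a k + a * u by ring, add_re, add_re, re_mul_lineCentre]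
    have h1 : (a * c₀ + b).re ≤ ‖a * c₀ + b‖ := re_le_norm _
    have h2 : (a * u).re ≤ ‖a‖ := by
      refine (re_le_norm _).trans ?_
      rw [norm_mul]
      exact mul_le_of_le_one_right (norm_nonneg _) hu.le
    simp only [M]
    linarith

/-- `m₀ x + m₁ (a x + b) ≡ c` with `m₀, m₁ ∈ ℤ` and `Im a ≠ 0` forces `m₀ = m₁ = 0`. [folklore] -/
theorem lineCoeffs_eq_zero (ha : a.im ≠ 0) (m₀ m₁ : ℤ) (c : ℂ)
    (h : ∀ x : ℂ, (m₀ : ℂ) * x + (m₁ : ℂ) * (a * x + b) = c) : m₀ = 0 ∧ m₁ = 0 := by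
  have h0 := h 0
  have h1 := h 1
  have hlin : (m₀ : ℂ) + (m₁ : ℂ) * a = 0 := by linear_combination h1 - h0
  have him := congrArg Complex.im hlin
  simp only [add_im, Complex.intCast_im, mul_im, Complex.intCast_re, zero_mul, add_zero,
    zero_add, Complex.zero_im] at him
  have hm1 : (m₁ : ℝ) = 0 := by
    rcases mul_eq_zero.1 him with h | h
    · exact h
    · exact absurd h ha
  have hm1' : m₁ = 0 := by exact_mod_cast hm1
  have hm0 : (m₀ : ℂ) = 0 := by
    have : (m₁ : ℂ) = 0 := by exact_mod_cast hm1'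
    rw [this, zero_mul, add_zero] at hlin
    exact hlin
  exact ⟨by exact_mod_cast hm0, hm1'⟩

/-- A line of non-real slope is not a line of rational slope: `{x₁ = a x₀ + b, y₀ = q(y₁)}`
(`Im a ≠ 0`, `q ≠ 0`) satisfies all hypotheses of Mantova–Masser's case (dim-pi-S-1-free).
[folklore] -/
theorem mmCase_lineSurface (ha : a.im ≠ 0) (hq : q ≠ 0) :
    MMCaseDimPiOneFree (graphPolySurface (linePoly a b) q) :=
  ⟨isIrreducibleClosed_graphPolySurface _ _, graphPolySurface_inter_torusLocus_nonempty _ hq,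
    zariskiDim_graphPolySurface _ _, addProjDim_graphPolySurface _ hq,
    not_isRationalSlopeLine_graphPolySurface _ hq fun m₀ m₁ c h =>
      lineCoeffs_eq_zero b ha m₀ m₁ c fun x => by simpa only [eval_linePoly] using h x⟩

/-- **The unprojected-density question holds on the whole family of line surfaces of non-real
slope**: for `Im a ≠ 0`, `q(0) ≠ 0`, `W = {x₁ = a x₀ + b, y₀ = q(y₁)}` satisfies
`MMCaseDimPiOneFree W ∧ UnprojectedDense W`. (The general question, in particular the case of
lines of real irrational slope, remains open.) (new in this file) [folklore] -/
theorem unprojectedDensityQuestion_instance_line (ha : a.im ≠ 0) (hq0 : q.eval 0 ≠ 0) :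
    MMCaseDimPiOneFree (graphPolySurface (linePoly a b) q) ∧
      UnprojectedDense (graphPolySurface (linePoly a b) q) :=
  ⟨mmCase_lineSurface b q ha (fun h => hq0 (by rw [h, Polynomial.eval_zero])),
    unprojectedDense_lineSurface b q ha hq0⟩

/-- Example: `e^z + e^{iz} = 1` — the exponential points of `{x₁ = i x₀, y₀ + y₁ = 1}` are
Zariski dense in the surface (cf. Gallinaro arXiv:2203.13767 Ex. 8.9, `e^z + e^{iz} = -1`: existence
and density of the projections to `{w₁ + w₂ + 1 = 0}`). [folklore] -/
example : UnprojectedDense (graphPolySurface (linePoly I 0) (1 - Polynomial.X)) :=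
  unprojectedDense_lineSurface 0 _ (by simp) (by simp)

end Line

/-! ### Polynomial base curves: the leading-coefficient criterion -/

section Leading

/-- **Leading-term control of `Re p` under a bounded perturbation.** There is `C = C(p, R) ≥ 0`
with `Re p(c + v) ≤ Re(a_d c^d) + C ‖c‖^{d-1}` for all `‖c‖ ≥ 1`, `‖v‖ ≤ R`
(`d = deg p`, `a_d` the leading coefficient). [folklore] -/
theorem re_eval_add_le (p : Polynomial ℂ) {R : ℝ} (hR : 0 ≤ R) :
    ∃ C : ℝ, 0 ≤ C ∧ ∀ c v : ℂ, 1 ≤ ‖c‖ → ‖v‖ ≤ R →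
      (p.eval (c + v)).re ≤
        (p.leadingCoeff * c ^ p.natDegree).re + C * ‖c‖ ^ (p.natDegree - 1) := by
  set d := p.natDegree with hd
  set a := p.leadingCoeff with ha
  set B : ℝ := ∑ i ∈ Finset.range (p.eraseLead.natDegree + 1), ‖p.eraseLead.coeff i‖ with hB
  have hB0 : 0 ≤ B := Finset.sum_nonneg fun _ _ => norm_nonneg _
  refine ⟨(‖a‖ * (d * R) + B) * (1 + R) ^ (d - 1), by positivity, fun c v hc hv => ?_⟩
  have hsplit : p.eval (c + v) = p.eraseLead.eval (c + v) + a * (c + v) ^ d := by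
    conv_lhs => rw [← Polynomial.eraseLead_add_monomial_natDegree_leadingCoeff p]
    rw [Polynomial.eval_add, Polynomial.eval_monomial]
  have hc0 : 0 ≤ ‖c‖ := norm_nonneg _
  have hcv : ‖c + v‖ ≤ ‖c‖ * (1 + R) := by
    calc ‖c + v‖ ≤ ‖c‖ + ‖v‖ := norm_add_le _ _
      _ ≤ ‖c‖ + ‖c‖ * R := by nlinarith [norm_nonneg v]
      _ = ‖c‖ * (1 + R) := by ring
  have hcR : ‖c‖ ≤ ‖c‖ * (1 + R) := le_mul_of_one_le_right hc0 (by linarith)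
  have h1R : 1 ≤ ‖c‖ * (1 + R) := hc.trans hcR
  -- (i) the leading term
  have hi : ‖a * ((c + v) ^ d - c ^ d)‖ ≤ ‖a‖ * (d * R) * (1 + R) ^ (d - 1) * ‖c‖ ^ (d - 1) := by
    rw [norm_mul]
    have h := Literature.Geometry.Symplectic.RotationBranch.norm_pow_sub_pow_le hcv hcR d
    rw [add_sub_cancel_left, mul_pow] at h
    calc ‖a‖ * ‖(c + v) ^ d - c ^ d‖
        ≤ ‖a‖ * (d * (‖c‖ ^ (d - 1) * (1 + R) ^ (d - 1)) * ‖v‖) :=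
          mul_le_mul_of_nonneg_left h (norm_nonneg _)
      _ ≤ ‖a‖ * (d * (‖c‖ ^ (d - 1) * (1 + R) ^ (d - 1)) * R) := by gcongr
      _ = ‖a‖ * (d * R) * (1 + R) ^ (d - 1) * ‖c‖ ^ (d - 1) := by ring
  -- (ii) the lower-order terms
  have hii : ‖p.eraseLead.eval (c + v)‖ ≤ B * (1 + R) ^ (d - 1) * ‖c‖ ^ (d - 1) := by
    have h := norm_eval_le_sum_mul_pow p.eraseLead (c + v)
    have hmax : max 1 ‖c + v‖ ≤ ‖c‖ * (1 + R) := max_le h1R hcv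
    have hdeg : p.eraseLead.natDegree ≤ d - 1 := Polynomial.eraseLead_natDegree_le p
    calc ‖p.eraseLead.eval (c + v)‖ ≤ B * max 1 ‖c + v‖ ^ p.eraseLead.natDegree := h
      _ ≤ B * (‖c‖ * (1 + R)) ^ p.eraseLead.natDegree := by gcongr
      _ ≤ B * (‖c‖ * (1 + R)) ^ (d - 1) :=
          mul_le_mul_of_nonneg_left (pow_le_pow_right₀ h1R hdeg) hB0
      _ = B * (1 + R) ^ (d - 1) * ‖c‖ ^ (d - 1) := by rw [mul_pow]; ring
  rw [hsplit, show a * (c + v) ^ d = a * c ^ d + a * ((c + v) ^ d - c ^ d) by ring, add_re, add_re]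
  have e1 := (re_le_norm _).trans hii
  have e2 := (re_le_norm _).trans hi
  nlinarith [e1, e2]

variable {p q : Polynomial ℂ}

/-- `m₀ x + m₁ p(x) ≡ c` with `deg p ≥ 2` forces `m₀ = m₁ = 0`: the graph of a polynomial of
degree `≥ 2` lies on no line. [folklore] -/
theorem coeffs_eq_zero_of_two_le_natDegree (hd : 2 ≤ p.natDegree) (m₀ m₁ : ℤ) (c : ℂ)
    (h : ∀ x : ℂ, (m₀ : ℂ) * x + (m₁ : ℂ) * p.eval x = c) : m₀ = 0 ∧ m₁ = 0 := by
  have hP : Polynomial.C (m₀ : ℂ) * Polynomial.X + Polynomial.C (m₁ : ℂ) * p = Polynomial.C c :=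
    Polynomial.funext fun x => by
      simp only [Polynomial.eval_add, Polynomial.eval_mul, Polynomial.eval_C, Polynomial.eval_X]
      exact h x
  have hlc : p.leadingCoeff ≠ 0 :=
    Polynomial.leadingCoeff_ne_zero.2 (Polynomial.ne_zero_of_natDegree_gt (n := 0) (by omega))
  have hdc := congrArg (fun r => r.coeff p.natDegree) hP
  simp only [Polynomial.coeff_add, Polynomial.coeff_C_mul,
    Polynomial.coeff_X_of_ne_one (show p.natDegree ≠ 1 by omega), mul_zero, zero_add,
    Polynomial.coeff_natDegree, Polynomial.coeff_C_of_ne_zero (show p.natDegree ≠ 0 by omega)] at hdc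
  have hm1 : (m₁ : ℂ) = 0 := (mul_eq_zero.1 hdc).resolve_right hlc
  have h1c := congrArg (fun r => r.coeff 1) hP
  simp only [Polynomial.coeff_add, Polynomial.coeff_C_mul, Polynomial.coeff_X_one, mul_one, hm1,
    zero_mul, add_zero, Polynomial.coeff_C_of_ne_zero one_ne_zero] at h1c
  exact ⟨by exact_mod_cast h1c, by exact_mod_cast hm1⟩

/-- For `deg p ≥ 2` and `q ≠ 0`, `S_{p,q}` satisfies all hypotheses of Mantova–Masser's case
(dim-pi-S-1-free). [folklore] -/
theorem mmCase_graphPolySurface_of_two_le (hd : 2 ≤ p.natDegree) (hq : q ≠ 0) :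
    MMCaseDimPiOneFree (graphPolySurface p q) :=
  ⟨isIrreducibleClosed_graphPolySurface _ _, graphPolySurface_inter_torusLocus_nonempty _ hq,
    zariskiDim_graphPolySurface _ _, addProjDim_graphPolySurface _ hq,
    not_isRationalSlopeLine_graphPolySurface _ hq (coeffs_eq_zero_of_two_le_natDegree hd)⟩

/-- The escape scale `T_k = 2π(k+1)`. [folklore] -/
def escScale (k : ℕ) : ℝ := 2 * Real.pi * ((k : ℝ) + 1)

/-- `T_k ≥ 1`. [folklore] -/
theorem one_le_escScale (k : ℕ) : 1 ≤ escScale k := by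
  unfold escScale; nlinarith [Real.pi_gt_three, (Nat.cast_nonneg k : (0 : ℝ) ≤ k)]

/-- `T_k → ∞`. [folklore] -/
theorem tendsto_escScale : Tendsto escScale atTop atTop :=
  (tendsto_natCast_add_atTop 1).const_mul_atTop Real.two_pi_pos

variable (σ : ℤ)

/-- The signed escape centres `c_k(σ) = 2π(k+1) · σ i` (`σ = ±1`; the previous file used `σ = 1`).
[folklore] -/
def sgnCentre (k : ℕ) : ℂ := (escScale k : ℂ) * ((σ : ℂ) * I)

/-- `e^{c_k(σ)} = 1`. [folklore] -/
theorem exp_sgnCentre (k : ℕ) : exp (sgnCentre σ k) = 1 := by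
  have h : sgnCentre σ k = ((σ * ((k : ℤ) + 1) : ℤ) : ℂ) * (2 * Real.pi * I) := by
    simp only [sgnCentre, escScale]; push_cast; ring
  rw [h]; exact exp_int_mul_two_pi_mul_I _

variable {σ}

/-- `‖c_k(±1)‖ = T_k`. [folklore] -/
theorem norm_sgnCentre (hσ : σ = 1 ∨ σ = -1) (k : ℕ) : ‖sgnCentre σ k‖ = escScale k := by
  have hT : 0 ≤ escScale k := (zero_le_one.trans (one_le_escScale k))
  rcases hσ with rfl | rfl <;> simp [sgnCentre, abs_of_nonneg hT]

variable (σ)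

/-- `Re(a c_k(σ)^n) = T_k^n Re(a (σ i)^n)`. [folklore] -/
theorem re_mul_sgnCentre_pow (a : ℂ) (n k : ℕ) :
    (a * sgnCentre σ k ^ n).re = escScale k ^ n * (a * ((σ : ℂ) * I) ^ n).re := by
  rw [sgnCentre, mul_pow, ← Complex.ofReal_pow, ← mul_assoc, mul_comm a, mul_assoc,
    Complex.re_ofReal_mul]

/-- **The leading-coefficient criterion.** Let `deg p = d ≥ 1` with leading coefficient `a_d`,
and suppose `Re(a_d (σ i)^d) < 0` for a sign `σ = ±1`; let `q(0) ≠ 0`. Then the exponential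
points of `S_{p,q} = {x₁ = p(x₀), y₀ = q(y₁)}` are Zariski dense. (Along `z = log q(0) + 2π(k+1)σ i
+ u`, `Re p(z) ≤ -λ T_k^d + C T_k^{d-1} → -∞`, so degenerate escape applies.) Instances:
`p = X²` (the parabola surface of the previous file), `p = aX + b` with `Im a ≠ 0`, `p = i X³`,
`p = -X⁴`; NOT covered: `p = -X²`, `p = X³`, lines of real slope. (new in this file) [folklore] -/
theorem unprojectedDense_graphPolySurface_of_leadingCoeff (hd : 0 < p.natDegree)
    (hσ : σ = 1 ∨ σ = -1) (hlead : (p.leadingCoeff * ((σ : ℂ) * I) ^ p.natDegree).re < 0)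
    (hq0 : q.eval 0 ≠ 0) : UnprojectedDense (graphPolySurface p q) := by
  set d := p.natDegree with hd_def
  set lam : ℝ := -(p.leadingCoeff * ((σ : ℂ) * I) ^ d).re with hlam
  have hlam0 : 0 < lam := by simp only [hlam]; linarith
  set c₀ : ℂ := log (q.eval 0) with hc₀
  obtain ⟨C, -, hC⟩ := re_eval_add_le p (R := ‖c₀‖ + 1) (by positivity)
  have hlin : Tendsto (fun k => lam * escScale k - C) atTop atTop :=
    tendsto_atTop_add_const_right _ _ (tendsto_escScale.const_mul_atTop hlam0)
  have hKge : ∀ᶠ k in atTop, lam * escScale k - C ≤ escScale k ^ (d - 1) * (lam * escScale k - C) := by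
    filter_upwards [hlin.eventually_ge_atTop 0] with k hk
    exact le_mul_of_one_le_left hk (one_le_pow₀ (one_le_escScale k))
  refine unprojectedDense_graphPolySurface_of_degenerate hq0 (sgnCentre σ) (exp_sgnCentre σ) ?_
    (fun k => escScale k ^ (d - 1) * (lam * escScale k - C)) (tendsto_atTop_mono' atTop hKge hlin)
    (1 / lam) (C / lam) ?_ (Eventually.of_forall fun k u hu => ?_)
  · simp only [norm_sgnCentre hσ]; exact tendsto_escScale
  · filter_upwards [hKge] with k hk
    rw [norm_sgnCentre hσ]
    have hl : 0 ≤ 1 / lam := le_of_lt (one_div_pos.2 hlam0)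
    have hne : lam ≠ 0 := hlam0.ne'
    calc escScale k = 1 / lam * (lam * escScale k - C) + C / lam := by field_simp; ring
      _ ≤ 1 / lam * (escScale k ^ (d - 1) * (lam * escScale k - C)) + C / lam :=
          add_le_add (mul_le_mul_of_nonneg_left hk hl) le_rfl
  · have hcn : 1 ≤ ‖sgnCentre σ k‖ := by rw [norm_sgnCentre hσ]; exact one_le_escScale k
    have hv : ‖c₀ + u‖ ≤ ‖c₀‖ + 1 := (norm_add_le _ _).trans (by linarith [hu.le])
    have h := hC (sgnCentre σ k) (c₀ + u) hcn hv
    rw [re_mul_sgnCentre_pow, norm_sgnCentre hσ, show (p.leadingCoeff * ((σ : ℂ) * I) ^ d).re = -lam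
      by rw [hlam, neg_neg]] at h
    have hpow : escScale k ^ d = escScale k ^ (d - 1) * escScale k := by
      rw [← pow_succ, Nat.sub_add_cancel (show 1 ≤ d from hd)]
    rw [hpow] at h
    rw [show c₀ + sgnCentre σ k + u = sgnCentre σ k + (c₀ + u) by ring]
    nlinarith [h]

/-- Under the leading-coefficient criterion (`deg p ≥ 1`, `Re(a_d (σ i)^d) < 0`) and `q ≠ 0`,
`S_{p,q}` satisfies all hypotheses of Mantova–Masser's case (dim-pi-S-1-free): for `deg p ≥ 2` the
base is no line at all, for `deg p = 1` the criterion says `Im a₁ ≠ 0`. [folklore] -/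
theorem mmCase_graphPolySurface_of_leadingCoeff (hd : 0 < p.natDegree) (hσ : σ = 1 ∨ σ = -1)
    (hlead : (p.leadingCoeff * ((σ : ℂ) * I) ^ p.natDegree).re < 0) (hq : q ≠ 0) :
    MMCaseDimPiOneFree (graphPolySurface p q) := by
  rcases (show p.natDegree = 1 ∨ 2 ≤ p.natDegree by omega) with h1 | h2
  · have hp : p = linePoly (p.coeff 1) (p.coeff 0) := Polynomial.eq_X_add_C_of_natDegree_le_one h1.le
    have him : (p.coeff 1).im ≠ 0 := by
      intro him
      rw [← Polynomial.coeff_natDegree, h1, pow_one] at hlead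
      rcases hσ with rfl | rfl <;> simp [him] at hlead
    rw [hp]
    exact mmCase_lineSurface _ _ him hq
  · exact mmCase_graphPolySurface_of_two_le h2 hq

/-- **The unprojected-density question holds for every `S_{p,q}` under the leading-coefficient
criterion** (`deg p ≥ 1`, `Re(a_d (σ i)^d) < 0` for a sign `σ = ±1`, `q(0) ≠ 0`):
`MMCaseDimPiOneFree (S_{p,q}) ∧ UnprojectedDense (S_{p,q})`. This contains the line family
(`unprojectedDensityQuestion_instance_line`) and the parabola surface of the previous file. The
general question — in particular bases `x₁ = a x₀ + b` with `a` real irrational, `x₁ = -x₀²`,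
`x₁ = x₀³` — remains open. (new in this file) [folklore] -/
theorem unprojectedDensityQuestion_instance_leadingCoeff (hd : 0 < p.natDegree)
    (hσ : σ = 1 ∨ σ = -1) (hlead : (p.leadingCoeff * ((σ : ℂ) * I) ^ p.natDegree).re < 0)
    (hq0 : q.eval 0 ≠ 0) :
    MMCaseDimPiOneFree (graphPolySurface p q) ∧ UnprojectedDense (graphPolySurface p q) :=
  ⟨mmCase_graphPolySurface_of_leadingCoeff σ hd hσ hlead fun h => hq0 (by rw [h, Polynomial.eval_zero]),
    unprojectedDense_graphPolySurface_of_leadingCoeff σ hd hσ hlead hq0⟩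

/-- The parabola surface of `EACDensityQuestion` is `S_{X², 1-X}`. [folklore] -/
theorem graphPolySurface_sq_eq_mmParabola :
    graphPolySurface (Polynomial.X ^ 2) (1 - Polynomial.X) = mmParabola := by
  ext z
  rw [mem_graphPolySurface_iff, mem_mmParabola_iff]
  simp

/-- Example: the parabola surface `{x₁ = x₀², y₀ = 1 - y₁}` of `EACDensityQuestion`, recovered from
the criterion with `σ = 1` (`Re(1 · i²) = -1 < 0`). [folklore] -/
example : UnprojectedDense (graphPolySurface (Polynomial.X ^ 2) (1 - Polynomial.X)) :=
  unprojectedDense_graphPolySurface_of_leadingCoeff 1 (by simp) (Or.inl rfl) (by simp) (by simp)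

/-- Example: `e^z + e^{i z³} = 1` — `{x₁ = i x₀³, y₀ = 1 - y₁}` (`σ = -1`: `Re(i · (-i)³) =
Re(i · i) = -1 < 0`). [folklore] -/
example : UnprojectedDense
    (graphPolySurface (Polynomial.C I * Polynomial.X ^ 3) (1 - Polynomial.X)) := by
  refine unprojectedDense_graphPolySurface_of_leadingCoeff (-1) ?_ (Or.inr rfl) ?_ (by simp)
  · rw [Polynomial.natDegree_C_mul_X_pow 3 I I_ne_zero]; norm_num
  · rw [Polynomial.natDegree_C_mul_X_pow 3 I I_ne_zero, Polynomial.leadingCoeff_C_mul_X_pow]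
    norm_num [pow_succ, Complex.ext_iff]

end Leading

end Literature.ModelTheory.Zilber
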